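import Summits.HubbardSuperconductivity.HubbardSuperconductivity.Theorems.AnisotropyChordTransferSectors
import Summits.HubbardSuperconductivity.HubbardSuperconductivity.Theorems.AnisotropyChordTransferChain
import Summits.HubbardSuperconductivity.HubbardSuperconductivity.Theorems.AnisotropyChordTransferCondensate

/-!
# Route `AnisotropyChord` / H0 rotor rung, route (1): **THEOREM T** (ODLRO transfer across sectors) — the theory seat's
# `TransferTheorem` PROVED in Lean from its typed hypotheses
(theory seat `hubbard-h0-rotor-theory-1`, cycle 12, `PartE.lean`, memo ROTOR-THEORY-11 §175, THEOREM-T.md; prover seat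
`hubbard-h0-rotor-p1` g13 — landing plan item 5)

VERBATIM ports of the remaining typed statements of PartE.lean — hypothesis (H2) `SymmetricSectorGap`, (H3) `SectorZeroGlobalGround`,
LEMMA E `LadderExcessBound`, and `TransferTheorem` — and the PROOF `transferTheorem_holds : TransferTheorem`:
(H1) KLS anchor + (H2) symmetric `z = 1` gap + (H3) + (H4) + LEMMA E + TRANSFER ⇒ for every `ε > 0` and fixed `k`, eventually in
`L`, `⟨S⃗²⟩_{ψ_j} ≥ ⟨S⃗²⟩_{ψ_0} − ε|V|²` for `j ≤ k` (`FirstLinksUpTo Δ ε k`).  Ingredients: the one-link Temple step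
(`…TransferOneLink`), the variational floors `E(M±1)‖S^±a‖² ≤ ⟨S^±a, H S^±a⟩`, the energy staircase
`E(j) − E(0) ≤ Σ_{i<j} e⁺_i/N_i`, existence of Perron amplitudes in all integer sectors `|i| ≤ k+1` once the sector `0` has one,
and the abstract induction `abstract_chain` (`…TransferChain`).  (H4) and TRANSFER are theorems of the tree
(`perronTranslationInvariant_holds`, `spinSquaredTransfer_holds`); (H2), (H3), LEMMA E remain hypotheses here.
-/

set_option linter.dupNamespace false
set_option autoImplicit false

noncomputable section

open Finset Filter Topology
open Literature.MathematicalPhysics.QuantumLattice Literature.Probability.LatticeModels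
open Summit.HubbardSuperconductivity.HubbardSuperconductivity.Theorems.AnisotropyChord.InsertionEntropy
open Summit.HubbardSuperconductivity.HubbardSuperconductivity.Theorems.AnisotropyChord.Tower
open Summit.HubbardSuperconductivity.HubbardSuperconductivity.Theorems.AnisotropyChord

namespace Summit.HubbardSuperconductivity.HubbardSuperconductivity.Theorems.AnisotropyChord.Transfer

variable (L : ℕ) [NeZero L]

/-! ## The remaining typed statements of PartE.lean (verbatim) -/

/-- **HYPOTHESIS (H2) — symmetric-subspace gap `≥ c₁/L` in the sectors `|j| ≤ k`, TEMPLE FORM** (VERBATIM port of the theory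
seat's `SymmetricSectorGap`, PartE.lean).  For the Perron ground amplitude `a` of sector `j` and every translation-invariant unit
real amplitude `φ` of the same sector, `(c₁/L)·(1 − ⟨a, φ⟩²) ≤ ⟨φ, Hφ⟩ − E(j)` (z = 1: the lowest k = 0 excitation inside a sector
is a phonon PAIR, energy `≈ 2c·2π/L`; fails at the isotropic point).
[conjecture: theory seat hubbard-h0-rotor-theory-1, cycle 12, memo §175; OPEN — the H0-type spectral input] -/
def SymmetricSectorGap (Δ c₁ : ℝ) (k : ℕ) : Prop :=
  ∀ᶠ L : ℕ in atTop, ∀ [NeZero L], ∀ j : ℤ, |j| ≤ (k : ℤ) →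
    ∀ a φ : TensorIndex (TorusSite 2 L) 2 → ℝ,
      IsPerronSectorGroundAmplitude L Δ (j : ℝ) a →
      cplx L φ ∈ spinZSector (Λ := TorusSite 2 L) 1 (j : ℝ) →
      (∀ v σ, φ (shiftCfg L v σ) = φ σ) → ∑ σ, φ σ ^ 2 = 1 →
        c₁ / (L : ℝ) * (1 - (∑ σ, a σ * φ σ) ^ 2) ≤ energyQ L Δ φ - sectorE L Δ (j : ℝ)

/-- **(H3) the `Sᶻ = 0` sector carries the global ground energy** (VERBATIM port of the theory seat's `SectorZeroGlobalGround`,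
PartE.lean; Mattis 1979 / Nishimori 1981-type, provable: `H(Δ)`, `|Δ| ≤ 1`, is stoquastic in the `Sˣ` basis).
[conjecture: support statement, provable; memo §175] -/
def SectorZeroGlobalGround (Δ : ℝ) : Prop :=
  ∀ (L : ℕ) [NeZero L] (M : ℝ) (a : TensorIndex (TorusSite 2 L) 2 → ℝ),
    IsPerronSectorGroundAmplitude L Δ M a → sectorE L Δ 0 ≤ sectorE L Δ M

/-- **LEMMA E — ladder excess bound** (VERBATIM port of the theory seat's `LadderExcessBound`, PartE.lean; exact form
`= (1−Δ)⟨a, D a⟩`, `D = Σ_b[2(SˣSˣ+SʸSʸ) − 4SᶻSᶻ]`, `|⟨D⟩| ≤ 2|E_b| ≤ 4L²`):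
`(R(S⁺a) − E)‖S⁺a‖² + (R(S⁻a) − E)‖S⁻a‖² ≤ 4(1−Δ)L²`.
[conjecture: theory seat hubbard-h0-rotor-theory-1, cycle 12, memo §175 — PROVED on paper (double commutator); Lean-open] -/
def LadderExcessBound : Prop :=
  ∀ (L : ℕ) [NeZero L] (Δ M : ℝ), Δ ≤ 1 →
    ∀ a : TensorIndex (TorusSite 2 L) 2 → ℝ, IsPerronSectorGroundAmplitude L Δ M a →
      (energyQ L Δ (raiseSum a) - sectorE L Δ M * raiseNormSq a)
        + (energyQ L Δ (lowerSum a) - sectorE L Δ M * lowerNormSq a) ≤ 4 * (1 - Δ) * (L : ℝ) ^ 2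

/-- **THEOREM T (ODLRO transfer across sectors)** (VERBATIM port of the theory seat's `TransferTheorem`, PartE.lean):
(H1)+(H2)+(H3)+(H4) + LEMMA E + TRANSFER ⇒ XY-LM₀(ε) on the first `k` links, eventually in `L`.
[conjecture: theory seat hubbard-h0-rotor-theory-1, cycle 12, memo §175 — PROVED on paper, conditional on (H2); Lean proof below] -/
def TransferTheorem : Prop :=
  ∀ (Δ c₀ c₁ : ℝ) (k : ℕ), 0 ≤ Δ → Δ < 1 → 0 < c₀ → 0 < c₁ →
    HalfFillingAnchor Δ c₀ → SymmetricSectorGap Δ c₁ (k + 1) → SectorZeroGlobalGround Δ →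
    PerronTranslationInvariant Δ → LadderExcessBound → SpinSquaredTransfer →
      ∀ ε : ℝ, 0 < ε → FirstLinksUpTo Δ ε k

variable {L}

/-! ## THEOREM T -/

set_option maxHeartbeats 400000 in
/-- **THEOREM T HOLDS** (as the implication typed by the theory seat): (H1) + (H2) + (H3) + (H4) + LEMMA E + TRANSFER ⇒
`∀ ε > 0, FirstLinksUpTo Δ ε k`.  Proof = THEOREM-T.md's induction, assembled from the one-link Temple step, the variational
floors, the energy staircase and `abstract_chain`. [conjecture: theory seat hubbard-h0-rotor-theory-1, cycle 12, memo §175 —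
THEOREM T; Lean proof here] -/
theorem transferTheorem_holds : TransferTheorem := by
  intro Δ c₀ c₁ k hΔ0 hΔ1 hc₀ hc₁ hA hGap hGlob hInv hLE _hTR ε hε
  -- constants
  obtain ⟨ε', hε'pos, hε'le, hε'c⟩ : ∃ ε' : ℝ, 0 < ε' ∧ ε' ≤ ε ∧ ε' ≤ c₀ / 2 :=
    ⟨min ε (c₀ / 2), lt_min hε (by linarith), min_le_left _ _, min_le_right _ _⟩
  obtain ⟨η, hηdef⟩ : ∃ η : ℝ, η = 1 - Δ := ⟨_, rfl⟩
  have hη0 : 0 ≤ η := by rw [hηdef]; linarith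
  obtain ⟨ν, hνdef⟩ : ∃ ν : ℝ, ν = c₀ / 4 := ⟨_, rfl⟩
  have hν0 : 0 < ν := by rw [hνdef]; positivity
  have hk1 : (0 : ℝ) < (k : ℝ) + 1 := by positivity
  obtain ⟨θ, hθdef⟩ : ∃ θ : ℝ, θ = ε' / ((k : ℝ) + 1) := ⟨_, rfl⟩
  have hθ0 : 0 < θ := by rw [hθdef]; positivity
  have hkθ : (k : ℝ) * θ ≤ ε' := by
    rw [hθdef, mul_div_assoc', div_le_iff₀ hk1]; nlinarith [hε'pos.le, hk1]
  obtain ⟨Dsum, hDsum⟩ : ∃ D : ℝ, D = ∑ i ∈ range (k + 1), dSeq η ν i := ⟨_, rfl⟩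
  -- largeness of L
  have hT1 : ∀ᶠ L : ℕ in atTop, Dsum ≤ c₁ * θ * (L : ℝ) := by
    have ht : Tendsto (fun L : ℕ => c₁ * θ * (L : ℝ)) atTop atTop :=
      Tendsto.const_mul_atTop (by positivity) tendsto_natCast_atTop_atTop
    exact ht.eventually_ge_atTop _
  have hT2 : ∀ᶠ L : ℕ in atTop, (k : ℝ) ^ 2 + k ≤ ν * ((L : ℝ) ^ 2) ^ 2 := by
    have ht : Tendsto (fun L : ℕ => ν * ((L : ℝ) ^ 2) ^ 2) atTop atTop := by
      apply Tendsto.const_mul_atTop hν0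
      have h4 : (fun L : ℕ => ((L : ℝ) ^ 2) ^ 2) = fun L : ℕ => (L : ℝ) ^ 4 := by funext L; ring
      rw [h4]; exact (tendsto_pow_atTop (by norm_num)).comp tendsto_natCast_atTop_atTop
    exact ht.eventually_ge_atTop _
  have hT3 : ∀ᶠ L : ℕ in atTop, 2 * (k + 2) ≤ L := Filter.eventually_ge_atTop _
  filter_upwards [hA, hGap, hT1, hT2, hT3] with L hAL hGapL hT1L hT2L hT3L
  intro _ j hj a₀ a ha₀ ha
  -- the torus size
  obtain ⟨V, hVdef⟩ : ∃ V : ℝ, V = (Fintype.card (TorusSite 2 L) : ℝ) := ⟨_, rfl⟩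
  have hV : V = (L : ℝ) ^ 2 := by
    rw [hVdef, Fintype.card_fun, ZMod.card, Fintype.card_fin]; push_cast; ring
  have hLsq : 2 * (k + 2) ≤ L ^ 2 := le_trans hT3L (Nat.le_self_pow two_ne_zero L)
  have hVk : (2 : ℝ) * (k + 2) ≤ V := by rw [hV]; exact_mod_cast hLsq
  have hk0 : (0 : ℝ) ≤ k := Nat.cast_nonneg k
  have hV2 : (2 : ℝ) ≤ V := by linarith
  have hVpos : 0 < V := by linarith
  have hVsq : 2 * V ≤ V ^ 2 := by nlinarith
  -- Perron amplitudes in the sectors 0 … k+1 and −1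
  have hexN : ∀ i : ℕ, i ≤ k + 1 → ∃ b : TensorIndex (TorusSite 2 L) 2 → ℝ,
      IsPerronSectorGroundAmplitude L Δ (i : ℝ) b := fun i hi => exists_perron_nat ha₀ i (by omega)
  choose! ψ hψ using hexN
  obtain ⟨ψm, hψm⟩ := exists_perron_neg_one ha₀ (by omega)
  have hψ0 : IsPerronSectorGroundAmplitude L Δ 0 (ψ 0) := by
    have := hψ 0 (Nat.zero_le _); rwa [Nat.cast_zero] at this
  -- replace the given amplitudes by the chosen ones (Perron uniqueness)
  have ea₀ : a₀ = ψ 0 := perron_eq ha₀ hψ0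
  have ea : a = ψ j := perron_eq ha (hψ j (by omega))
  rw [ea₀, ea]
  -- the sequences (opaque, with defining equations)
  obtain ⟨f, hf⟩ : ∃ f : ℕ → ℝ, ∀ i, f i =
      Summit.HubbardSuperconductivity.HubbardSuperconductivity.Theorems.AnisotropyChord.Tower.totalSpinSq (ψ i) (i : ℝ) :=
    ⟨_, fun _ => rfl⟩
  obtain ⟨N, hN⟩ : ∃ N : ℕ → ℝ, ∀ i, N i = raiseNormSq (ψ i) := ⟨_, fun _ => rfl⟩
  obtain ⟨Nt, hNt'⟩ : ∃ Nt : ℕ → ℝ, ∀ i, Nt i = lowerNormSq (ψ i) := ⟨_, fun _ => rfl⟩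
  obtain ⟨E, hE⟩ : ∃ E : ℝ → ℝ, ∀ x, E x = sectorE L Δ x := ⟨_, fun _ => rfl⟩
  obtain ⟨ep, hep⟩ : ∃ ep : ℕ → ℝ, ∀ i, ep i = energyQ L Δ (raiseSum (ψ i)) - E i * N i := ⟨_, fun _ => rfl⟩
  -- per-sector facts
  have hNdef : ∀ i, i ≤ k → N i = f i - (i : ℝ) ^ 2 - i := by
    intro i hi; rw [hN, hf]; exact raiseNormSq_eq_totalSpinSq (hψ i (by omega))
  have hNtdef : ∀ i, Nt i = f i - (i : ℝ) ^ 2 + i := by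
    intro i; rw [hNt', hf]; exact lowerNormSq_eq_totalSpinSq (i : ℝ) (ψ i)
  have hftop : ∀ i, i ≤ k + 1 → f i ≤ (V / 2) * (V / 2 + 1) := by
    intro i hi; rw [hf, hVdef]; exact totalSpinSq_le_top (hψ i hi)
  have hNt0 : ∀ i, i ≤ k → 0 ≤ Nt i := by
    intro i _; rw [hNt']; exact Finset.sum_nonneg fun τ _ => sq_nonneg _
  have hN0 : ∀ i, 0 ≤ N i := by
    intro i; rw [hN]; exact Finset.sum_nonneg fun σ _ => sq_nonneg _
  have hNt : ∀ i, i ≤ k → Nt i ≤ V ^ 2 := by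
    intro i hi
    rw [hNtdef i]
    have h1 := hftop i (by omega)
    have hik : (i : ℝ) ≤ k := by exact_mod_cast hi
    have hsq : 0 ≤ (i : ℝ) ^ 2 := sq_nonneg _
    have e : V / 2 * (V / 2 + 1) = V ^ 2 / 4 + V / 2 := by ring
    rw [e] at h1
    linarith
  have hNle : ∀ i, i ≤ k → N i ≤ V ^ 2 := by
    intro i hi
    rw [hNdef i hi]
    have h1 := hftop i (by omega)
    have hi0 : (0 : ℝ) ≤ i := Nat.cast_nonneg _
    have hsq : 0 ≤ (i : ℝ) ^ 2 := sq_nonneg _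
    have e : V / 2 * (V / 2 + 1) = V ^ 2 / 4 + V / 2 := by ring
    rw [e] at h1
    linarith
  -- variational floors and LEMMA E
  have hup : ∀ i, i ≤ k → (E ((i : ℝ) + 1) - E i) * N i ≤ ep i := by
    intro i hi
    have := sectorE_succ_mul_le (hψ i (by omega))
    rw [hep, hE, hE, hN]; linarith
  have hdown : ∀ i, i ≤ k → E ((i : ℝ) - 1) * Nt i ≤ energyQ L Δ (lowerSum (ψ i)) := by
    intro i hi; rw [hE, hNt']; exact sectorE_pred_mul_le (hψ i (by omega))
  have hLEi : ∀ i, i ≤ k → ep i + (energyQ L Δ (lowerSum (ψ i)) - E i * Nt i) ≤ 4 * η * V := by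
    intro i hi
    have := hLE L Δ (i : ℝ) (by linarith) (ψ i) (hψ i (by omega))
    rw [hep, hE, hN, hNt', hηdef, hV]; linarith
  have hE0 : ∀ i, i ≤ k + 1 → E 0 ≤ E i := by
    intro i hi; rw [hE, hE]; exact hGlob L (i : ℝ) (ψ i) (hψ i hi)
  have hE0m : E 0 ≤ E (-1) := by rw [hE, hE]; exact hGlob L (-1) ψm hψm
  -- the excess bounds
  have hep0 : ep 0 ≤ 4 * η * V := by
    have h1 := hLEi 0 (Nat.zero_le _)
    have h2 := hdown 0 (Nat.zero_le _)
    have h3 := hNt0 0 (Nat.zero_le _)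
    have e : ((0 : ℕ) : ℝ) - 1 = -1 := by norm_num
    rw [e] at h2
    rw [Nat.cast_zero] at h1
    have h4 := mul_le_mul_of_nonneg_right hE0m h3
    linarith
  have hepi : ∀ i, 1 ≤ i → i ≤ k → 0 < N (i - 1) → ep i ≤ 4 * η * V + ep (i - 1) / N (i - 1) * Nt i := by
    intro i hi1 hik hNp
    have h1 := hLEi i hik
    have h2 := hdown i hik
    have h3 := hup (i - 1) (by omega)
    have ecast : (((i - 1 : ℕ) : ℝ)) = (i : ℝ) - 1 := by rw [Nat.cast_sub hi1]; simp
    have ecast' : (((i - 1 : ℕ) : ℝ)) + 1 = (i : ℝ) := by rw [ecast]; ring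
    rw [ecast'] at h3
    rw [← ecast] at h2
    have h4 : E (i : ℝ) - E (((i - 1 : ℕ) : ℝ)) ≤ ep (i - 1) / N (i - 1) := by
      rw [le_div_iff₀ hNp]; linarith
    have h5 := mul_le_mul_of_nonneg_right h4 (hNt0 i hik)
    have e5 : (E (i : ℝ) - E (((i - 1 : ℕ) : ℝ))) * Nt i = E (i : ℝ) * Nt i - E (((i - 1 : ℕ) : ℝ)) * Nt i := by ring
    rw [e5] at h5
    linarith
  -- the link inequality
  have hlink : ∀ i, i < k → (∀ m, m ≤ i → 0 < N m) →
      f i - (L : ℝ) / c₁ * (ep i + N i * ∑ m ∈ range i, ep m / N m) ≤ f (i + 1) := by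
    intro i hik hNp
    have hψi := hψ i (by omega)
    have hψi1 : IsPerronSectorGroundAmplitude L Δ ((i : ℝ) + 1) (ψ (i + 1)) := by
      have := hψ (i + 1) (by omega); push_cast at this; exact this
    -- the gap hypothesis at the sector i+1
    have hgap : ∀ φ : TensorIndex (TorusSite 2 L) 2 → ℝ,
        cplx L φ ∈ spinZSector (Λ := TorusSite 2 L) 1 ((i : ℝ) + 1) → (∀ v σ, φ (shiftCfg L v σ) = φ σ) →
        ∑ σ, φ σ ^ 2 = 1 →
          c₁ / (L : ℝ) * (1 - (∑ σ, ψ (i + 1) σ * φ σ) ^ 2) ≤ energyQ L Δ φ - sectorE L Δ ((i : ℝ) + 1) := by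
      intro φ hφ hφinv hφunit
      have ecast : (((i + 1 : ℕ) : ℤ) : ℝ) = (i : ℝ) + 1 := by push_cast; ring
      have habs : |((i + 1 : ℕ) : ℤ)| ≤ ((k + 1 : ℕ) : ℤ) := by
        rw [abs_of_nonneg (by positivity)]; exact_mod_cast (by omega : i + 1 ≤ k + 1)
      have h := hGapL ((i + 1 : ℕ) : ℤ) habs (ψ (i + 1)) φ
        (by rw [ecast]; exact hψi1) (by rw [ecast]; exact hφ) hφinv hφunit
      rw [ecast] at h; exact h
    have hone := totalSpinSq_succ_ge_of_gap hc₁ hψi hψi1 hgap (hInv L (i : ℝ) (ψ i) hψi)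
      (by have := hNp i le_rfl; rwa [hN] at this)
    -- staircase: E i − E(i+1) ≤ E i − E 0 ≤ Σ_{m<i} ep m / N m
    have hstair : E (i : ℝ) - E 0 ≤ ∑ m ∈ range i, ep m / N m := by
      have htel : ∑ m ∈ range i, (E ((m : ℝ) + 1) - E m) = E (i : ℝ) - E 0 := by
        have := Finset.sum_range_sub (fun m => E (m : ℝ)) i
        simp only [Nat.cast_succ, Nat.cast_zero] at this
        exact this
      rw [← htel]
      apply Finset.sum_le_sum
      intro m hm
      have hmi : m ≤ i := (mem_range.mp hm).le
      rw [le_div_iff₀ (hNp m hmi)]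
      exact hup m (by omega)
    have hE01 : E 0 ≤ E ((i : ℝ) + 1) := by
      have := hE0 (i + 1) (by omega); push_cast at this; exact this
    have hNi := hN0 i
    have hbound : energyQ L Δ (raiseSum (ψ i)) - sectorE L Δ ((i : ℝ) + 1) * raiseNormSq (ψ i)
        ≤ ep i + N i * ∑ m ∈ range i, ep m / N m := by
      have e1 : energyQ L Δ (raiseSum (ψ i)) = ep i + E i * N i := by rw [hep]; ring
      rw [e1, ← hE, ← hN]
      have h2 : (E (i : ℝ) - E ((i : ℝ) + 1)) * N i ≤ (E (i : ℝ) - E 0) * N i :=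
        mul_le_mul_of_nonneg_right (by linarith) hNi
      have h3 : (E (i : ℝ) - E 0) * N i ≤ N i * ∑ m ∈ range i, ep m / N m := by
        rw [mul_comm]; exact mul_le_mul_of_nonneg_left hstair hNi
      linarith
    have hL0 : 0 ≤ (L : ℝ) / c₁ := div_nonneg (Nat.cast_nonneg _) hc₁.le
    have h4 := mul_le_mul_of_nonneg_left hbound hL0
    rw [hf, hf]
    push_cast
    linarith
  -- floor and largeness
  have hf0 : c₀ * V ^ 2 ≤ f 0 := by
    have h := hAL (ψ 0) hψ0
    have e0 : condensateDensity (ψ 0) = lowerNormSq (ψ 0) / V ^ 2 := by rw [hVdef]; rfl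
    rw [e0, le_div_iff₀ (by positivity)] at h
    have : f 0 = lowerNormSq (ψ 0) := by
      rw [hf]
      unfold Summit.HubbardSuperconductivity.HubbardSuperconductivity.Theorems.AnisotropyChord.Tower.totalSpinSq
      push_cast; ring
    rw [this]; exact h
  have hfloor : ∀ i, i ≤ k → ν * V ^ 2 ≤ f 0 - (i : ℝ) * θ * V ^ 2 - (i : ℝ) ^ 2 - i := by
    intro i hi
    have hik : (i : ℝ) ≤ k := by exact_mod_cast hi
    have hi0 : (0 : ℝ) ≤ i := Nat.cast_nonneg _
    have h1 : (i : ℝ) * θ ≤ ε' := le_trans (mul_le_mul_of_nonneg_right hik hθ0.le) hkθ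
    have h2a : (i : ℝ) ^ 2 ≤ (k : ℝ) ^ 2 := pow_le_pow_left₀ hi0 hik 2
    have h3 : (k : ℝ) ^ 2 + k ≤ ν * V ^ 2 := by rw [hV]; exact hT2L
    have hV4 : 0 ≤ V ^ 2 := sq_nonneg _
    have h5 := mul_le_mul_of_nonneg_right h1 hV4
    have h6 := mul_le_mul_of_nonneg_right hε'c hV4
    rw [hνdef] at h3 ⊢
    linarith
  have hLr : ∀ i, i ≤ k → (L : ℝ) * V * dSeq η ν i ≤ c₁ * θ * V ^ 2 := by
    intro i hi
    have h1 : dSeq η ν i ≤ Dsum := by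
      rw [hDsum]
      exact Finset.single_le_sum (f := fun m => dSeq η ν m) (fun m _ => dSeq_nonneg hη0 hν0 m)
        (mem_range.mpr (by omega))
    have hL0 : (0 : ℝ) ≤ L := Nat.cast_nonneg _
    have h2 : (L : ℝ) * dSeq η ν i ≤ c₁ * θ * V := by
      rw [hV]
      calc (L : ℝ) * dSeq η ν i ≤ (L : ℝ) * Dsum := mul_le_mul_of_nonneg_left h1 hL0
        _ ≤ (L : ℝ) * (c₁ * θ * (L : ℝ)) := mul_le_mul_of_nonneg_left hT1L hL0
        _ = c₁ * θ * (L : ℝ) ^ 2 := by ring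
    calc (L : ℝ) * V * dSeq η ν i = V * ((L : ℝ) * dSeq η ν i) := by ring
      _ ≤ V * (c₁ * θ * V) := mul_le_mul_of_nonneg_left h2 hVpos.le
      _ = c₁ * θ * V ^ 2 := by ring
  -- the abstract induction
  have hchain := abstract_chain k hη0 hν0 hc₁ hθ0 hVpos (Nat.cast_nonneg L) f N Nt ep hNdef hNt hNt0 hNle hep0 hepi
    hlink hfloor hLr j hj
  have hjθ : (j : ℝ) * θ ≤ ε' :=
    le_trans (mul_le_mul_of_nonneg_right (by exact_mod_cast hj : (j : ℝ) ≤ k) hθ0.le) hkθ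
  have hV4 : 0 ≤ V ^ 2 := sq_nonneg _
  have h1 := hchain.1
  have e0 : Summit.HubbardSuperconductivity.HubbardSuperconductivity.Theorems.AnisotropyChord.Tower.totalSpinSq (ψ 0) 0 = f 0 := by
    rw [hf, Nat.cast_zero]
  rw [e0, ← hf j, ← hVdef]
  have h7 := mul_le_mul_of_nonneg_right hjθ hV4
  have h8 := mul_le_mul_of_nonneg_right hε'le hV4
  linarith

end Summit.HubbardSuperconductivity.HubbardSuperconductivity.Theorems.AnisotropyChord.Transfer
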